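import Mathlib

/-!
# Kernel vectors of positive Toeplitz matrices of corank one have all their roots on the unit circle
# (corollary of Carathéodory–Fejér 1911; Connes–van Suijlekom 2025, Cor. 1.1 / Prop. 2.2)

Source, read verbatim (held text `paper:arxiv-2511.23257`): A. Connes, W. D. van Suijlekom,
*Quadratic Forms, Real Zeros and Echoes of the Spectral Action*, Comm. Math. Phys. **406** (2025) =
arXiv:2511.23257 [bib: `ConnesSuijlekom2025`], §1 Corollary 1.1 and §2 Propositions 2.1–2.2:

> **Corollary 1.1.** Let `T ∈ M_{n+1}(ℂ)` be a Hermitian, positive semidefinite Toeplitz matrix of rank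
> `n`, and let `ξ ∈ ker T`. Then all the zeros of the polynomial `P(z) := Σ_{j=0}^n ξ_j z^j` lie on the
> unit circle.

(In the paper this is "a direct corollary of the Carathéodory–Fejér theorem" `T = V D V^*`; §2 gives a
`C^*`-algebraic proof — Prop. 2.1: the positive functional `φ(X^j) = c_j` on `ℂ[X, X⁻¹]/(P)`; Prop. 2.2:
in the GNS representation `π` of `(ℂ[X,X⁻¹], φ)`, of dimension `n`, `π(X)` is unitary and `P ∈ ker π`, so
the roots of `P` are eigenvalues of a unitary. The authors: "This corollary exhibits a striking
number-theoretic flavor, resonating with the analogue of the Riemann Hypothesis for function fields".)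

## What is here

* `ConnesVanSuijlekom.norm_eq_one_of_toeplitz_kernel`: Prop. 2.2 with "rank `n`" phrased as "the kernel
  of `T` is the line `ℂ ξ`" (`ξ ≠ 0`, `T ξ = 0`, every kernel vector is a multiple of `ξ`): every complex
  root `z` of `Σ ξ_j z^j` has `‖z‖ = 1`.
* `ConnesVanSuijlekom.norm_eq_one_of_toeplitz_rank`: the same with the printed hypothesis `rank T = n`
  (rank–nullity turns it into the previous one).

## Proof given here (the GNS argument of Prop. 2.2 in coordinates)

Identify `ℂ^{n+1}` with polynomials of degree `≤ n`; `⟨f ∣ g⟩_T = Σ conj(f_i) T_{ik} g_k` is a positive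
form whose radical is `ℂ P`, and by the Toeplitz property multiplication by `X` preserves it on
polynomials of degree `< n` ("`π(X)` is unitary"). If `P(z) = 0`, write `P = (X - z) f`; then
`X f = P + z f`, so `⟨Xf ∣ Xf⟩_T = |z|² ⟨f ∣ f⟩_T` (because `P` is in the radical), while Toeplitz gives
`⟨Xf ∣ Xf⟩_T = ⟨f ∣ f⟩_T`. If `⟨f ∣ f⟩_T = 0` then `T f = 0`, `f ∈ ℂ P`, impossible by degrees; hence
`|z|² = 1`. No Carathéodory–Fejér factorisation and no `C^*`-envelope is needed.

Deliberately NOT here: the Carathéodory–Fejér structure theorem itself; the real case Prop. 2.1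
(palindromy of `P`, the functional `φ`); anything about number theory.
-/

open Finset Matrix Complex Polynomial

open scoped ComplexConjugate ComplexOrder

namespace Literature.LinearAlgebra.Matrix

namespace ConnesVanSuijlekom

/-- **C–vS Prop. 2.2 / Cor. 1.1 (Carathéodory–Fejér corollary), kernel form.** Let `T` be a positive
semi-definite `(n+1) × (n+1)` complex Toeplitz matrix (`T_{ij} = c_{i-j}`) whose kernel is the line
spanned by `ξ ≠ 0`. Then every root `z ∈ ℂ` of `P(z) = Σ_{j=0}^{n} ξ_j z^j` lies on the unit circle.
[cite: ConnesSuijlekom2025, Proposition 2.2 and Corollary 1.1] -/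
theorem norm_eq_one_of_toeplitz_kernel (n : ℕ) {T : Matrix (Fin (n + 1)) (Fin (n + 1)) ℂ}
    {c : ℤ → ℂ} (hT : ∀ i j : Fin (n + 1), T i j = c ((i : ℤ) - (j : ℤ))) (hpsd : T.PosSemidef)
    {ξ : Fin (n + 1) → ℂ} (hξ0 : ξ ≠ 0) (hTξ : T *ᵥ ξ = 0)
    (hker : ∀ v : Fin (n + 1) → ℂ, T *ᵥ v = 0 → ∃ t : ℂ, v = t • ξ)
    {z : ℂ} (hz : ∑ j : Fin (n + 1), ξ j * z ^ (j : ℕ) = 0) : ‖z‖ = 1 := by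
  -- the polynomial `P = Σ ξ_j X^j`: coefficients, `P ≠ 0`, `deg P ≤ n`, `P(z) = 0`
  obtain ⟨P, hPdef⟩ : ∃ P : ℂ[X], P = ∑ j : Fin (n + 1), C (ξ j) * X ^ (j : ℕ) := ⟨_, rfl⟩
  have hPcoeff : ∀ j : Fin (n + 1), P.coeff j = ξ j := by
    intro j
    rw [hPdef, finsetSum_coeff]
    simp only [coeff_C_mul, coeff_X_pow]
    rw [Finset.sum_eq_single j]
    · simp
    · intro k _ hkj
      rw [if_neg (fun h => hkj (Fin.ext (by exact_mod_cast h.symm))), mul_zero]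
    · intro h
      exact absurd (Finset.mem_univ j) h
  have hPcoeff' : ∀ m : ℕ, n < m → P.coeff m = 0 := by
    intro m hm
    rw [hPdef, finsetSum_coeff]
    refine Finset.sum_eq_zero fun k _ => ?_
    simp only [coeff_C_mul, coeff_X_pow]
    rw [if_neg (by have := k.2; omega), mul_zero]
  have hP0 : P ≠ 0 := by
    intro h
    apply hξ0
    funext j
    rw [← hPcoeff j, h, coeff_zero, Pi.zero_apply]
  have hPdeg : P.natDegree ≤ n := (natDegree_le_iff_coeff_eq_zero).mpr hPcoeff'
  have hroot : P.IsRoot z := by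
    rw [IsRoot, hPdef, eval_finsetSum]
    simpa using hz
  -- factor `P = (X - z) f`
  obtain ⟨f, hf⟩ : ∃ f : ℂ[X], (X - C z) * f = P := ⟨_, mul_divByMonic_eq_iff_isRoot.mpr hroot⟩
  have hf0 : f ≠ 0 := by
    intro h
    rw [h, mul_zero] at hf
    exact hP0 hf.symm
  have hfdeg : f.natDegree + 1 ≤ n := by
    have h := congrArg natDegree hf
    rw [natDegree_mul (X_sub_C_ne_zero z) hf0, natDegree_X_sub_C] at h
    omega
  -- `X f = P + z f`, coefficientwise
  have hXf : ∀ m : ℕ, (X * f).coeff m = P.coeff m + z * f.coeff m := by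
    intro m
    have h := congrArg (fun p : ℂ[X] => p.coeff m) hf
    simp only [sub_mul, coeff_sub, coeff_C_mul] at h
    linear_combination h
  -- the coefficient vectors `x` of `f` and `y` of `X f` in degrees `0 … n`
  obtain ⟨x, hx⟩ : ∃ x : Fin (n + 1) → ℂ, ∀ j, x j = f.coeff j := ⟨fun j => f.coeff j, fun _ => rfl⟩
  obtain ⟨y, hy⟩ : ∃ y : Fin (n + 1) → ℂ, ∀ j, y j = (X * f).coeff j :=
    ⟨fun j => (X * f).coeff j, fun _ => rfl⟩
  have hyx : ∀ j, y j = ξ j + z * x j := fun j => by rw [hy, hx, hXf, hPcoeff]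
  have hy0 : y 0 = 0 := by rw [hy, Fin.val_zero, coeff_X_mul_zero]
  have hysucc : ∀ i : Fin n, y i.succ = x (Fin.castSucc i) := fun i => by
    rw [hy, hx, Fin.val_succ, coeff_X_mul, Fin.val_castSucc]
  have hxlast : x (Fin.last n) = 0 := by
    rw [hx, Fin.val_last]
    exact coeff_eq_zero_of_natDegree_lt (by omega)
  -- Toeplitz: `T_{i+1,k+1} = T_{ik}`
  have hshift : ∀ i k : Fin n, T i.succ k.succ = T (Fin.castSucc i) (Fin.castSucc k) := by
    intro i k
    rw [hT, hT]
    congr 1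
    push_cast [Fin.val_succ, Fin.val_castSucc]
    ring
  -- (1) "`π(X)` is unitary": `⟨Xf ∣ Xf⟩_T = ⟨f ∣ f⟩_T`
  have htoe : ∑ i, conj (y i) * ∑ k, T i k * y k = ∑ i, conj (x i) * ∑ k, T i k * x k := by
    have inner_y : ∀ i : Fin (n + 1), ∑ k, T i k * y k = ∑ k : Fin n, T i k.succ * x (Fin.castSucc k) := by
      intro i
      rw [Fin.sum_univ_succ, hy0, mul_zero, zero_add]
      exact Finset.sum_congr rfl fun k _ => by rw [hysucc]
    have inner_x : ∀ i : Fin (n + 1), ∑ k, T i k * x k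
        = ∑ k : Fin n, T i (Fin.castSucc k) * x (Fin.castSucc k) := by
      intro i
      rw [Fin.sum_univ_castSucc, hxlast, mul_zero, add_zero]
    rw [Fin.sum_univ_succ, hy0, map_zero, zero_mul, zero_add]
    rw [Fin.sum_univ_castSucc, hxlast, map_zero, zero_mul, add_zero]
    refine Finset.sum_congr rfl fun i _ => ?_
    rw [hysucc, inner_y, inner_x]
    congr 1
    exact Finset.sum_congr rfl fun k _ => by rw [hshift]
  -- (2) "`P` is in the radical": `⟨Xf ∣ Xf⟩_T = |z|² ⟨f ∣ f⟩_T`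
  have hTξ' : ∀ i, ∑ k, T i k * ξ k = 0 := fun i => by
    have h := congr_fun hTξ i
    simpa [mulVec, dotProduct] using h
  have hherm : ∀ i k, conj (T k i) = T i k := fun i k => by
    simpa using hpsd.1.apply i k
  have hξT : ∀ k, ∑ i, conj (ξ i) * T i k = 0 := by
    intro k
    have h := congrArg conj (hTξ' k)
    rw [map_sum, map_zero] at h
    rw [← h]
    refine Finset.sum_congr rfl fun i _ => ?_
    rw [map_mul, hherm, mul_comm]
  have hTy : ∀ i, ∑ k, T i k * y k = z * ∑ k, T i k * x k := by
    intro i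
    rw [Finset.mul_sum, ← add_zero (∑ k, z * (T i k * x k)), ← hTξ' i, ← Finset.sum_add_distrib]
    exact Finset.sum_congr rfl fun k _ => by rw [hyx]; ring
  have hrad : ∑ i, conj (y i) * ∑ k, T i k * y k = (conj z * z) * ∑ i, conj (x i) * ∑ k, T i k * x k := by
    have hcross : ∑ i, conj (ξ i) * ∑ k, T i k * x k = 0 := by
      calc ∑ i, conj (ξ i) * ∑ k, T i k * x k
          = ∑ i, ∑ k, conj (ξ i) * T i k * x k := by
            refine Finset.sum_congr rfl fun i _ => ?_
            rw [Finset.mul_sum]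
            exact Finset.sum_congr rfl fun k _ => by ring
        _ = ∑ k, ∑ i, conj (ξ i) * T i k * x k := Finset.sum_comm
        _ = ∑ k, (∑ i, conj (ξ i) * T i k) * x k := by
            refine Finset.sum_congr rfl fun k _ => ?_
            rw [Finset.sum_mul]
        _ = 0 := by simp [hξT]
    calc ∑ i, conj (y i) * ∑ k, T i k * y k
        = ∑ i, (conj (ξ i) + conj z * conj (x i)) * (z * ∑ k, T i k * x k) := by
          refine Finset.sum_congr rfl fun i _ => ?_
          rw [hTy, hyx, map_add, map_mul]
      _ = z * ∑ i, conj (ξ i) * ∑ k, T i k * x k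
          + (conj z * z) * ∑ i, conj (x i) * ∑ k, T i k * x k := by
          rw [Finset.mul_sum, Finset.mul_sum, ← Finset.sum_add_distrib]
          exact Finset.sum_congr rfl fun i _ => by ring
      _ = (conj z * z) * ∑ i, conj (x i) * ∑ k, T i k * x k := by rw [hcross, mul_zero, zero_add]
  -- (3) `(|z|² - 1) ⟨f ∣ f⟩_T = 0`
  have hq : star x ⬝ᵥ (T *ᵥ x) = ∑ i, conj (x i) * ∑ k, T i k * x k := by
    simp [dotProduct, mulVec]
  have hmain : (conj z * z - 1) * (star x ⬝ᵥ (T *ᵥ x)) = 0 := by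
    rw [hq]
    linear_combination (-1 : ℂ) * (htoe.symm.trans hrad)
  rcases mul_eq_zero.mp hmain with h1 | h2
  · -- `|z|² = 1`
    have h : (normSq z : ℂ) = 1 := by rw [normSq_eq_conj_mul_self]; exact sub_eq_zero.mp h1
    have h' : ‖z‖ ^ 2 = 1 := by
      rw [Complex.sq_norm]
      exact_mod_cast h
    exact (pow_eq_one_iff_of_nonneg (norm_nonneg z) two_ne_zero).mp h'
  · -- `⟨f ∣ f⟩_T = 0` forces `f ∈ ℂ P`, impossible by degrees
    exfalso
    have hTx : T *ᵥ x = 0 := (hpsd.dotProduct_mulVec_zero_iff x).mp h2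
    obtain ⟨t, ht⟩ := hker x hTx
    have hfP : f = C t * P := by
      ext m
      rw [coeff_C_mul]
      by_cases hm : m ≤ n
      · have h1 := hx ⟨m, by omega⟩
        have h2 := hPcoeff ⟨m, by omega⟩
        simp only at h1 h2
        rw [← h1, h2, ht, Pi.smul_apply, smul_eq_mul]
      · rw [hPcoeff' m (by omega), mul_zero]
        exact coeff_eq_zero_of_natDegree_lt (by omega)
    by_cases ht0 : t = 0
    · rw [ht0, C_0, zero_mul] at hfP
      exact hf0 hfP
    · have h := congrArg natDegree hf
      rw [hfP, natDegree_mul (X_sub_C_ne_zero z) (mul_ne_zero (C_ne_zero.mpr ht0) hP0),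
        natDegree_X_sub_C, natDegree_C_mul ht0] at h
      omega

/-- **C–vS Cor. 1.1 / Prop. 2.2, as printed** ("positive Toeplitz matrix of size `n + 1` and rank `n`,
`ξ ∈ ker T`"): for such `T` and any non-zero kernel vector `ξ`, all roots of `Σ ξ_j z^j` have modulus
one. [cite: ConnesSuijlekom2025, Corollary 1.1 and Proposition 2.2] -/
theorem norm_eq_one_of_toeplitz_rank (n : ℕ) {T : Matrix (Fin (n + 1)) (Fin (n + 1)) ℂ}
    {c : ℤ → ℂ} (hT : ∀ i j : Fin (n + 1), T i j = c ((i : ℤ) - (j : ℤ))) (hpsd : T.PosSemidef)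
    (hrank : T.rank = n) {ξ : Fin (n + 1) → ℂ} (hξ0 : ξ ≠ 0) (hTξ : T *ᵥ ξ = 0)
    {z : ℂ} (hz : ∑ j : Fin (n + 1), ξ j * z ^ (j : ℕ) = 0) : ‖z‖ = 1 := by
  refine norm_eq_one_of_toeplitz_kernel n hT hpsd hξ0 hTξ (fun v hv => ?_) hz
  -- rank–nullity: `dim ker T = (n + 1) - n = 1`, and `ξ ≠ 0` spans it
  have hk : Module.finrank ℂ (LinearMap.ker T.mulVecLin) = 1 := by
    have h := LinearMap.finrank_range_add_finrank_ker T.mulVecLin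
    rw [Module.finrank_fin_fun] at h
    have hr : Module.finrank ℂ (LinearMap.range T.mulVecLin) = n := hrank
    omega
  have hξk : ξ ∈ LinearMap.ker T.mulVecLin := by simpa using hTξ
  have hvk : v ∈ LinearMap.ker T.mulVecLin := by simpa using hv
  have hne : (⟨ξ, hξk⟩ : LinearMap.ker T.mulVecLin) ≠ 0 := by
    intro h
    exact hξ0 (congrArg Subtype.val h)
  obtain ⟨t, ht⟩ := (finrank_eq_one_iff_of_nonzero' _ hne).mp hk ⟨v, hvk⟩
  exact ⟨t, (congrArg Subtype.val ht).symm⟩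

end ConnesVanSuijlekom

end Literature.LinearAlgebra.Matrix
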